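import Literature.AlgebraicGeometry.Motives.AbelianVarietyCotangentHomBaseChange
import HarnessLib

/-!
# Tangent vectors at the origin versus the cotangent map: `T_e(f) = 0 ⇔ f^* = 0` on `𝔪_e/𝔪_e²`

Let `f : A → B` be a homomorphism of abelian varieties over a field `K`, with cotangent map
`f^* : 𝔪_{e_B}/𝔪_{e_B}² → 𝔪_{e_A}/𝔪_{e_A}²` (`AbelianVariety.Hom.cotangentMap`,
`Motives/AbelianVarietyCotangentHom`; for an endomorphism `AbelianVariety.cotangentMap`).  The tree
speaks about the tangent map `T_e(f)` in two currencies: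

* the **cotangent currency** `Hom.cotangentMap f` (a `K`-linear map), and
* the **points currency** of `Motives/AbelianVarietyTangentTranslation` /
  `Motives/AbelianVarietyFrobeniusFactor`: for a field `L ⊇ K`, an `L[ε]`-valued point
  `t : Spec L[ε] → A` over `K` lies *at the origin* when its restriction along `L[ε] → L` is the
  trivial point, `Spec(fst) ≫ t = 1`, and `f` *kills* it when `t ≫ f = 1`
  (Görtz–Wedhorn I, (6.4), Prop. 6.7: tangent vectors as `k[ε]`-valued points; Görtz–Wedhorn II,
  Rem. 27.18 (4): `Lie(A) = Ker(A(k[ε]) → A(k))`).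

This file is the dictionary between the two (the «bridge E / E′» of the cell's E2 road):

* `forall_tangent_comp_eq_one_of_cotangentMap_eq_zero` — **(E)** if `f^* = 0` then `f` kills every
  `L[ε]`-point of `A` at the origin, for EVERY field `L ⊇ K` (endomorphism form
  `forall_tangent_comp_eq_one_of_cotangentMap_end_eq_zero`);
* `tangent_eq_one_of_comp_eq_one_of_cotangentMap_surjective` — **(E′)** if `f^*` is surjective
  (e.g. bijective: `f` étale at `e`) then `f` is injective on `L[ε]`-points at the origin;
* `cotangentMap_eq_zero_of_forall_tangent_comp_eq_one`, `cotangentMap_eq_zero_iff_forall_tangent_comp_eq_one`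
  — conversely `K[ε]`-points suffice to detect `f^* = 0` (tangent vectors separate `𝔪_e/𝔪_e²`,
  `mem_sq_of_forall_eq_zero` of `Motives/AbelianVarietyLie`).

The proofs go through the local homomorphism `ev_t : 𝒪_{A,e} → R` of a point `t : Spec R → A` at the
origin (`evAt`, `ptOfStalkHom_evAt` of `Motives/AbelianVarietyLie`), for any local `K`-algebra `R`:

* `evAt_one_left`, `eq_one_iff_forall_evAt_eq_zero` — `ev_1 = (K → R) ∘ ev_e`, and a point at the
  origin is trivial iff `ev_t` kills `𝔪_e` (`𝒪_{A,e} = K ⊕ 𝔪_e`);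
* `Hom.evAt_comp_toSchemeHom` — `ev_{t ≫ f} = ev_t ∘ f^*` (the endomorphism case is
  `evAt_comp_toSchemeHom` of `Motives/AbelianVarietyFrobeniusKernel`);
* `comp_hom_eq_one_of_forall_sq_of_cotangentMap_eq_zero` — if `ev_t(𝔪_e²) = 0` and
  `f^*(𝔪_{e_B}) ⊆ 𝔪_{e_A}²` then `t ≫ f = 1`;
* for `R = L[ε]`: `fst ∘ ev_t = ev_1` kills `𝔪_e`, so `ev_t(𝔪_e) ⊆ εL` and `ev_t(𝔪_e²) = 0`
  (`fst_evAt_eq_zero_of_fst_comp_eq_one`, `evAt_eq_zero_of_mem_sq_of_fst_comp_eq_one`).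

Theorems only (no definition, no named fact, no instance).  Cell `hodgecm-mathlib` (D-0151), fan A
rung A-II (h21), E2 «height-one road», a banked leaf: consumed by the assembly of
`shimuraTaniyamaPair_degOne'` (stub `stub_tangentKill`: the reduction of a multiplication
`ι(α)`, `α ∈ 𝔮`, has zero cotangent map, hence kills the `K(Ã)[ε]`-points at the origin).

## References

* [GortzWedhorn2020] U. Görtz, T. Wedhorn, *Algebraic Geometry I* (2nd ed., 2020): Def. 6.2,
  Remark 6.3 (3), (6.4) and Prop. 6.7 (p. 184), Remark 6.12 (2) (p. 188).
* [GortzWedhorn2023] U. Görtz, T. Wedhorn, *Algebraic Geometry II* (2023): Def. 27.17,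
  Rem. 27.18 (1)–(4) (pp. 805–806).
* [Shimura1998] G. Shimura, *Abelian Varieties with Complex Multiplication and Modular Functions*
  (1998), §2.8 (the differential `δλ` of a homomorphism), Prop. 6; §13.1 (p. 129).
* [StacksProject] The Stacks project, Tag 01J7 (Lemma 26.13.3: morphisms from spectra of local rings).
-/

universe u

open CategoryTheory CategoryTheory.Limits AlgebraicGeometry

noncomputable section

namespace Literature.AlgebraicGeometry.Motives

namespace AbelianVariety

open scoped MonObj
open AlgPoints

variable {K : Type u} [Field K] {A B : AbelianVariety K}

/-! ### Points at the origin with values in a local `K`-algebra and their local homomorphisms -/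

section LocalPoints

variable {R : Type u} [CommRing R] [Algebra K R] [IsLocalRing R]

omit [IsLocalRing R] in
/-- The trivial `R`-point of `A` is the trivial `K`-point composed with `Spec R → Spec K`.
[cite: GortzWedhorn2020, Section (4.7) and Remark 6.12 (1) (p. 188)] -/
theorem one_left_eq_specMap_comp_one_left :
    (1 : specOver K R ⟶ A.X).left =
      Spec.map (CommRingCat.ofHom (algebraMap K R)) ≫ (1 : specOver K K ⟶ A.X).left := by
  rw [one_left, one_left]
  change Spec.map (CommRingCat.ofHom (algebraMap K R)) ≫ unitPt A =
    Spec.map (CommRingCat.ofHom (algebraMap K R)) ≫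
      (Spec.map (CommRingCat.ofHom (algebraMap K K)) ≫ unitPt A)
  rw [Algebra.algebraMap_self, CommRingCat.ofHom_id, Spec.map_id, Category.id_comp]

/-- **`ev_1 = (K → R) ∘ ev_e`**: the local homomorphism `𝒪_{A,e} → R` of the trivial `R`-point is
evaluation at the origin followed by the structure map (functoriality of `ev` in `R`,
`evAt_SpecMap_comp`). [cite: StacksProject, Tag 01J7 (Lemma 26.13.3: morphisms from spectra of local rings)] -/
theorem evAt_one_left
    (h : (1 : specOver K R ⟶ A.X).left.base (IsLocalRing.closedPoint R) = origin A) :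
    evAt (R := CommRingCat.of R) (1 : specOver K R ⟶ A.X).left h =
      CommRingCat.ofHom ((algebraMap K R).comp (evalOrigin A)) := by
  haveI : IsLocalHom
      (CommRingCat.ofHom (algebraMap K R) : CommRingCat.of K ⟶ CommRingCat.of R).hom := by
    rw [CommRingCat.hom_ofHom]; infer_instance
  have key := one_left_eq_specMap_comp_one_left (A := A) (R := R)
  have h' : (Spec.map (CommRingCat.ofHom (algebraMap K R)) ≫ (1 : specOver K K ⟶ A.X).left).base
      (IsLocalRing.closedPoint R) = origin A := by
    rw [← key]; exact h
  rw [evAt_congr key h h',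
    evAt_SpecMap_comp (CommRingCat.ofHom (algebraMap K R)) (1 : specOver K K ⟶ A.X).left
      (one_left_base _) h']
  rfl

/-- `ev_1` kills `𝔪_e` (`ev_1 = (K → R) ∘ ev_e` and `ev_e(𝔪_e) = 0`).
[cite: StacksProject, Tag 01J7 (Lemma 26.13.3: morphisms from spectra of local rings)] -/
theorem evAt_one_left_apply_eq_zero
    (h : (1 : specOver K R ⟶ A.X).left.base (IsLocalRing.closedPoint R) = origin A)
    {a : stalkOrigin A} (ha : a ∈ IsLocalRing.maximalIdeal (stalkOrigin A)) :
    evAt (R := CommRingCat.of R) (1 : specOver K R ⟶ A.X).left h a = 0 := by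
  rw [evAt_one_left h]
  change algebraMap K R (evalOrigin A a) = 0
  rw [evalOrigin_eq_zero_of_mem A ha, map_zero]

/-- **A point at the origin is trivial iff its local homomorphism kills `𝔪_e`.**  For a local
`K`-algebra `R` and an `R`-point `t : Spec R → A` over `K` mapping the closed point to `e`:
`t = 1 ↔ ev_t(𝔪_e) = 0` (both `ev_t` and `ev_1` are `K`-algebra maps, `𝒪_{A,e} = K ⊕ 𝔪_e`, and a
point is determined by its local homomorphism, `ptOfStalkHom_evAt`).
[cite: StacksProject, Tag 01J7 (Lemma 26.13.3: morphisms from spectra of local rings)]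
[cite: GortzWedhorn2023, Rem. 27.18 (4) (p. 806)] -/
theorem eq_one_iff_forall_evAt_eq_zero (t : specOver K R ⟶ A.X)
    (ht : t.left.base (IsLocalRing.closedPoint R) = origin A) :
    t = 1 ↔ ∀ a ∈ IsLocalRing.maximalIdeal (stalkOrigin A),
      evAt (R := CommRingCat.of R) t.left ht a = 0 := by
  constructor
  · rintro rfl a ha
    exact evAt_one_left_apply_eq_zero ht ha
  · intro h
    have h1 : (1 : specOver K R ⟶ A.X).left.base (IsLocalRing.closedPoint R) = origin A :=
      one_left_base _
    apply Over.OverMorphism.ext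
    rw [← ptOfStalkHom_evAt (R := CommRingCat.of R) t.left ht,
      ← ptOfStalkHom_evAt (R := CommRingCat.of R) (1 : specOver K R ⟶ A.X).left h1]
    congr 1
    apply CommRingCat.hom_ext
    ext a
    obtain ⟨c, hc⟩ := exists_sub_algebraMap_mem_maximalIdeal A a
    have e : a = (a - stalkOriginAlgebraMap A c) + stalkOriginAlgebraMap A c :=
      (sub_add_cancel a _).symm
    have ht' := RingHom.congr_fun (evAt_comp_algebraMap t ht) c
    have h1' := RingHom.congr_fun (evAt_comp_algebraMap (1 : specOver K R ⟶ A.X) h1) c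
    rw [RingHom.comp_apply] at ht' h1'
    rw [e, map_add, map_add, ht', h1']
    change evAt (R := CommRingCat.of R) t.left ht (a - stalkOriginAlgebraMap A c) + _ =
      evAt (R := CommRingCat.of R) (1 : specOver K R ⟶ A.X).left h1 (a - stalkOriginAlgebraMap A c) + _
    rw [h _ hc, evAt_one_left_apply_eq_zero h1 hc]

/-- A point at the origin composed with a homomorphism `f : A → B` is a point of `B` at the origin
(`f(e_A) = e_B`). [cite: GortzWedhorn2020, Remark 6.3 (3)] -/
theorem comp_hom_left_base_closedPoint (t : specOver K R ⟶ A.X)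
    (ht : t.left.base (IsLocalRing.closedPoint R) = origin A) (f : A ⟶ B) :
    (t ≫ f.hom.hom.hom).left.base (IsLocalRing.closedPoint R) = origin B := by
  change (t.left ≫ Hom.toSchemeHom f).base (IsLocalRing.closedPoint R) = origin B
  rw [Scheme.Hom.comp_apply, ht, toSchemeHom_origin]

/-- **Functoriality of the local homomorphism in a homomorphism `f : A → B`:**
`ev_{t ≫ f} = ev_t ∘ f^*` (the endomorphism case is `evAt_comp_toSchemeHom`; Görtz–Wedhorn I,
Remark 6.3 (3): the local homomorphism `f_x^♯`, compatible with composition).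
[cite: GortzWedhorn2020, Remark 6.3 (3)] -/
theorem Hom.evAt_comp_toSchemeHom {R : CommRingCat.{u}} [IsLocalRing R] (t : Spec R ⟶ A.X.left)
    (ht : t.base (IsLocalRing.closedPoint R) = origin A) (f : A ⟶ B)
    (ht' : (t ≫ Hom.toSchemeHom f).base (IsLocalRing.closedPoint R) = origin B) :
    evAt (t ≫ Hom.toSchemeHom f) ht' = Hom.stalkMapOrigin f ≫ evAt t ht := by
  have key : t ≫ Hom.toSchemeHom f = ptOfStalkHom (Hom.stalkMapOrigin f ≫ evAt t ht) := by
    conv_lhs => rw [← ptOfStalkHom_evAt t ht]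
    rw [Hom.ptOfStalkHom_comp_toSchemeHom]
  haveI := Hom.isLocalHom_stalkMapOrigin f
  haveI : IsLocalHom (Hom.stalkMapOrigin f ≫ evAt t ht).hom := by
    rw [CommRingCat.hom_comp]; infer_instance
  rw [evAt_congr key ht' (key ▸ ht'), evAt_ptOfStalkHom]

/-- **Core of the bridge.**  Let `t : Spec R → A` be a point at the origin whose local homomorphism
kills `𝔪_e²` (e.g. an `L[ε]`-point, `evAt_eq_zero_of_mem_sq_of_fst_comp_eq_one`), and let
`f : A → B` have zero cotangent map, i.e. `f^*(𝔪_{e_B}) ⊆ 𝔪_{e_A}²`.  Then `f` kills `t`: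
`ev_{t ≫ f} = ev_t ∘ f^*` kills `𝔪_{e_B}`, so `t ≫ f = 1` (`eq_one_iff_forall_evAt_eq_zero`).
[cite: GortzWedhorn2023, Rem. 27.18 (1) and (4) (pp. 805–806)] -/
theorem comp_hom_eq_one_of_forall_sq_of_cotangentMap_eq_zero (t : specOver K R ⟶ A.X)
    (ht : t.left.base (IsLocalRing.closedPoint R) = origin A)
    (h2 : ∀ a ∈ IsLocalRing.maximalIdeal (stalkOrigin A) ^ 2,
      evAt (R := CommRingCat.of R) t.left ht a = 0)
    (f : A ⟶ B) (hf : Hom.cotangentMap f = 0) : t ≫ f.hom.hom.hom = 1 := by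
  have ht' := comp_hom_left_base_closedPoint t ht f
  rw [eq_one_iff_forall_evAt_eq_zero _ ht']
  intro b hb
  have hfb : Hom.stalkMapOrigin f b ∈ IsLocalRing.maximalIdeal (stalkOrigin A) ^ 2 := by
    have h := LinearMap.congr_fun hf (Cotangent.mk B ⟨b, hb⟩)
    rw [Hom.cotangentMap_mk, LinearMap.zero_apply, Cotangent.mk_eq_zero_iff] at h
    exact h
  have e : evAt (R := CommRingCat.of R) (t ≫ f.hom.hom.hom).left ht' =
      Hom.stalkMapOrigin f ≫ evAt (R := CommRingCat.of R) t.left ht :=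
    Hom.evAt_comp_toSchemeHom (R := CommRingCat.of R) t.left ht f _
  rw [e, CommRingCat.comp_apply]
  exact h2 _ hfb

end LocalPoints

/-! ### `L[ε]`-valued points at the origin (`L ⊇ K` a field) -/

section DualNumber

open TrivSqZeroExt

variable (L : Type u) [Field L] [Algebra K L]

/-- An `L[ε]`-point of `A` over `K` whose restriction along `L[ε] → L` is trivial maps the closed
point to the origin. [cite: GortzWedhorn2023, Rem. 27.18 (4) (p. 806)] -/
theorem base_eq_origin_of_fst_comp_eq_one (t : specOver K (DualNumber L) ⟶ A.X)
    (ht : specOverMapOfAlgHom (fstHom K L L) ≫ t = 1) :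
    t.left.base (IsLocalRing.closedPoint (DualNumber L)) = origin A := by
  haveI : IsLocalHom (CommRingCat.ofHom (fstHom K L L).toRingHom :
      CommRingCat.of (DualNumber L) ⟶ CommRingCat.of L).hom :=
    ⟨fun _ hx => isUnit_iff_isUnit_fst.mpr hx⟩
  have h1 : (specOverMapOfAlgHom (fstHom K L L)).left.base (IsLocalRing.closedPoint L) =
      IsLocalRing.closedPoint (DualNumber L) := by
    rw [specOverMapOfAlgHom_left]
    exact Spec_closedPoint (f := CommRingCat.ofHom (fstHom K L L).toRingHom)
  rw [← h1, ← Scheme.Hom.comp_apply, ← Over.comp_left, ht]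
  exact one_left_base _

/-- **`fst ∘ ev_t = (K → L) ∘ ev_e`** for an `L[ε]`-point `t` at the origin: the constant part of
the local homomorphism `𝒪_{A,e} → L[ε]` of `t` is evaluation at the origin (it is the local
homomorphism of `Spec(fst) ≫ t = 1`). [cite: GortzWedhorn2020, (6.4) and Proposition 6.7 (p. 184), Remark 6.12 (2) (p. 188)] -/
theorem evAt_comp_fstHom_of_fst_comp_eq_one (t : specOver K (DualNumber L) ⟶ A.X)
    (ht : specOverMapOfAlgHom (fstHom K L L) ≫ t = 1)
    (h0 : t.left.base (IsLocalRing.closedPoint (DualNumber L)) = origin A) :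
    evAt (R := CommRingCat.of (DualNumber L)) t.left h0 ≫
        CommRingCat.ofHom (fstHom K L L).toRingHom =
      CommRingCat.ofHom ((algebraMap K L).comp (evalOrigin A)) := by
  haveI : IsLocalHom (CommRingCat.ofHom (fstHom K L L).toRingHom :
      CommRingCat.of (DualNumber L) ⟶ CommRingCat.of L).hom :=
    ⟨fun _ hx => isUnit_iff_isUnit_fst.mpr hx⟩
  have hψ : Spec.map (CommRingCat.ofHom (fstHom K L L).toRingHom) ≫ t.left =
      (1 : specOver K L ⟶ A.X).left := by
    rw [← ht, Over.comp_left, specOverMapOfAlgHom_left]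
    rfl
  have h1 : (Spec.map (CommRingCat.ofHom (fstHom K L L).toRingHom) ≫ t.left).base
      (IsLocalRing.closedPoint L) = origin A := by
    rw [hψ]; exact one_left_base _
  rw [← evAt_SpecMap_comp (CommRingCat.ofHom (fstHom K L L).toRingHom) t.left h0 h1,
    evAt_congr hψ h1 (one_left_base _), evAt_one_left]

/-- The constant part of `ev_t(a)` vanishes for `a ∈ 𝔪_e`: `ev_t(𝔪_e) ⊆ εL` for an `L[ε]`-point `t`
at the origin. [cite: GortzWedhorn2020, (6.4) and Proposition 6.7 (p. 184), Remark 6.12 (2) (p. 188)] -/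
theorem fst_evAt_eq_zero_of_fst_comp_eq_one (t : specOver K (DualNumber L) ⟶ A.X)
    (ht : specOverMapOfAlgHom (fstHom K L L) ≫ t = 1)
    (h0 : t.left.base (IsLocalRing.closedPoint (DualNumber L)) = origin A)
    {a : stalkOrigin A} (ha : a ∈ IsLocalRing.maximalIdeal (stalkOrigin A)) :
    (evAt (R := CommRingCat.of (DualNumber L)) t.left h0 a).fst = 0 := by
  have h := congrArg (fun φ : stalkOrigin A ⟶ CommRingCat.of L => φ a)
    (evAt_comp_fstHom_of_fst_comp_eq_one L t ht h0)
  change (evAt (R := CommRingCat.of (DualNumber L)) t.left h0 a).fst =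
    algebraMap K L (evalOrigin A a) at h
  rw [h, evalOrigin_eq_zero_of_mem A ha, map_zero]

/-- **`ev_t(𝔪_e²) = 0`** for an `L[ε]`-point `t` at the origin: `ev_t(𝔪_e) ⊆ εL` and `(εL)² = 0`.
[cite: GortzWedhorn2020, (6.4) and Proposition 6.7 (p. 184), Remark 6.12 (2) (p. 188)] -/
theorem evAt_eq_zero_of_mem_sq_of_fst_comp_eq_one (t : specOver K (DualNumber L) ⟶ A.X)
    (ht : specOverMapOfAlgHom (fstHom K L L) ≫ t = 1)
    (h0 : t.left.base (IsLocalRing.closedPoint (DualNumber L)) = origin A)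
    {a : stalkOrigin A} (ha : a ∈ IsLocalRing.maximalIdeal (stalkOrigin A) ^ 2) :
    evAt (R := CommRingCat.of (DualNumber L)) t.left h0 a = 0 := by
  rw [pow_two] at ha
  refine Submodule.mul_induction_on ha (fun x hx y hy => ?_)
    (fun x y hx hy => by rw [map_add, hx, hy, add_zero])
  have hx0 := fst_evAt_eq_zero_of_fst_comp_eq_one L t ht h0 hx
  have hy0 := fst_evAt_eq_zero_of_fst_comp_eq_one L t ht h0 hy
  rw [map_mul]
  apply TrivSqZeroExt.ext
  · rw [fst_mul, hx0, zero_mul, fst_zero]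
  · rw [snd_mul, hx0, hy0, zero_smul, MulOpposite.op_zero, zero_smul, add_zero, snd_zero]

/-- **(E) Zero cotangent map ⇒ zero tangent map on `L[ε]`-points, for every field `L ⊇ K`.**  If the
cotangent map `f^* : 𝔪_{e_B}/𝔪_{e_B}² → 𝔪_{e_A}/𝔪_{e_A}²` of a homomorphism `f : A → B` vanishes, then
`f` kills every `L[ε]`-valued point of `A` at the origin: `Spec(fst) ≫ t = 1 ⇒ t ≫ f = 1`
(Görtz–Wedhorn II, Rem. 27.18 (1), (4): `T_e(f)` on `Lie(A) = Ker(A(L[ε]) → A(L))` is the dual of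
`f^*`; Shimura §2.8: `δλ = 0`).  Partially applied, `… L f hf` is literally the hypothesis of
`comp_eq_lift_comp_of_forall_tangent_comp_eq_one` / `exists_eq_relFrobenius_comp_of_forall_tangent_comp_eq_one`.
[cite: GortzWedhorn2023, Rem. 27.18 (1) and (4) (pp. 805–806)] [cite: Shimura1998, §2.8 Prop. 6] -/
theorem forall_tangent_comp_eq_one_of_cotangentMap_eq_zero (f : A ⟶ B)
    (hf : Hom.cotangentMap f = 0) (t : specOver K (DualNumber L) ⟶ A.X)
    (ht : specOverMapOfAlgHom (fstHom K L L) ≫ t = 1) : t ≫ f.hom.hom.hom = 1 :=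
  comp_hom_eq_one_of_forall_sq_of_cotangentMap_eq_zero t (base_eq_origin_of_fst_comp_eq_one L t ht)
    (fun _ ha => evAt_eq_zero_of_mem_sq_of_fst_comp_eq_one L t ht _ ha) f hf

/-- **(E), endomorphism form:** if `u^* = 0` on `𝔪_e/𝔪_e²` (`AbelianVariety.cotangentMap A u = 0`)
then `u` kills every `L[ε]`-point of `A` at the origin, for every field `L ⊇ K`.
[cite: GortzWedhorn2023, Rem. 27.18 (1) and (4) (pp. 805–806)] [cite: Shimura1998, §2.8 Prop. 6] -/
theorem forall_tangent_comp_eq_one_of_cotangentMap_end_eq_zero (u : A ⟶ A)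
    (hu : cotangentMap A u = 0) (t : specOver K (DualNumber L) ⟶ A.X)
    (ht : specOverMapOfAlgHom (fstHom K L L) ≫ t = 1) : t ≫ u.hom.hom.hom = 1 :=
  forall_tangent_comp_eq_one_of_cotangentMap_eq_zero L u
    (by rwa [← cotangentMap_eq_hom_cotangentMap]) t ht

/-- **(E′) Surjective cotangent map ⇒ injective tangent map on `L[ε]`-points.**  If
`f^* : 𝔪_{e_B}/𝔪_{e_B}² → 𝔪_{e_A}/𝔪_{e_A}²` is surjective (e.g. bijective, `f` étale at the origin),
then an `L[ε]`-point `t` of `A` at the origin with `t ≫ f = 1` is trivial: every `a ∈ 𝔪_{e_A}` is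
`f^* b` modulo `𝔪_{e_A}²`, and `ev_t(f^* b) = ev_{t ≫ f}(b) = 0`, `ev_t(𝔪_{e_A}²) = 0`.
[cite: GortzWedhorn2023, Rem. 27.18 (1) and (4) (pp. 805–806)] -/
theorem tangent_eq_one_of_comp_eq_one_of_cotangentMap_surjective (f : A ⟶ B)
    (hf : Function.Surjective (Hom.cotangentMap f)) (t : specOver K (DualNumber L) ⟶ A.X)
    (ht : specOverMapOfAlgHom (fstHom K L L) ≫ t = 1) (h : t ≫ f.hom.hom.hom = 1) : t = 1 := by
  have h0 := base_eq_origin_of_fst_comp_eq_one L t ht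
  have h0' := comp_hom_left_base_closedPoint t h0 f
  rw [eq_one_iff_forall_evAt_eq_zero _ h0]
  intro a ha
  obtain ⟨w, hw⟩ := hf (Cotangent.mk A ⟨a, ha⟩)
  obtain ⟨b, rfl⟩ := Cotangent.mk_surjective w
  rw [Hom.cotangentMap_mk, Cotangent.mk_eq_mk_iff] at hw
  have hb : evAt (R := CommRingCat.of (DualNumber L)) t.left h0 (Hom.stalkMapOrigin f b) = 0 := by
    have h1 := (eq_one_iff_forall_evAt_eq_zero _ h0').mp h b b.2
    have e : evAt (R := CommRingCat.of (DualNumber L)) (t ≫ f.hom.hom.hom).left h0' =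
        Hom.stalkMapOrigin f ≫ evAt (R := CommRingCat.of (DualNumber L)) t.left h0 :=
      Hom.evAt_comp_toSchemeHom (R := CommRingCat.of (DualNumber L)) t.left h0 f _
    rwa [e, CommRingCat.comp_apply] at h1
  have e : a = Hom.stalkMapOrigin f b - (Hom.stalkMapOrigin f b - a) := (sub_sub_cancel _ a).symm
  rw [e, map_sub, hb, evAt_eq_zero_of_mem_sq_of_fst_comp_eq_one L t ht h0 hw, sub_zero]

/-- **Converse of (E): `K[ε]`-points detect `f^* = 0`.**  If `f : A → B` kills every `K[ε]`-point of
`A` at the origin then `f^* = 0` on `𝔪_{e_B}/𝔪_{e_B}²`: for `b ∈ 𝔪_{e_B}` and every linear form `ℓ` on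
`𝔪_{e_A}/𝔪_{e_A}²` with tangent vector `t_ℓ` (`tangentPt`), `ℓ(f^* b) = ε`-part of
`ev_{t_ℓ ≫ f}(b) = 0`, and such `ℓ` separate `𝔪_{e_A}/𝔪_{e_A}²` (`mem_sq_of_forall_eq_zero`).
[cite: GortzWedhorn2023, Rem. 27.18 (1) and (4) (pp. 805–806)] -/
theorem cotangentMap_eq_zero_of_forall_tangent_comp_eq_one (f : A ⟶ B)
    (hf : ∀ t : specOver K (DualNumber K) ⟶ A.X,
      specOverMapOfAlgHom (fstHom K K K) ≫ t = 1 → t ≫ f.hom.hom.hom = 1) :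
    Hom.cotangentMap f = 0 := by
  apply LinearMap.ext
  intro w
  obtain ⟨b, rfl⟩ := Cotangent.mk_surjective w
  rw [Hom.cotangentMap_mk, LinearMap.zero_apply, Cotangent.mk_eq_zero_iff]
  apply mem_sq_of_forall_eq_zero (Hom.stalkMapOrigin_mem f b.2)
  intro ℓ hℓs hℓK hℓ2
  set t := tangentPt ℓ hℓs hℓK hℓ2 with ht_def
  have ht : specOverMapOfAlgHom (fstHom K K K) ≫ t.1 = 1 := (mem_kerAug_iff _ _).mp t.2
  have h0 := base_eq_origin_of_mem_kerAug (dualNumberAug K) t.2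
  have h0' := comp_hom_left_base_closedPoint t.1 h0 f
  have hb := (eq_one_iff_forall_evAt_eq_zero _ h0').mp (hf t.1 ht) b b.2
  have e : evAt (R := CommRingCat.of (DualNumber K)) (t.1 ≫ f.hom.hom.hom).left h0' =
      Hom.stalkMapOrigin f ≫ evAt (R := CommRingCat.of (DualNumber K)) t.1.left h0 :=
    Hom.evAt_comp_toSchemeHom (R := CommRingCat.of (DualNumber K)) t.1.left h0 f _
  rw [e, CommRingCat.comp_apply, evAt_tangentPt] at hb
  have hb' := congrArg TrivSqZeroExt.snd hb
  change (tangentHom ℓ hℓs hℓK hℓ2 (Hom.stalkMapOrigin f b)).snd = (0 : DualNumber K).snd at hb'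
  rwa [snd_tangentHom_apply, snd_zero] at hb'

/-- **`f^* = 0 ⇔ f` kills every `K[ε]`-point at the origin** (the dictionary between the cotangent
currency and the tangent-vector currency, Görtz–Wedhorn II, Rem. 27.18 (1), (4)).
[cite: GortzWedhorn2023, Rem. 27.18 (1) and (4) (pp. 805–806)] -/
theorem cotangentMap_eq_zero_iff_forall_tangent_comp_eq_one (f : A ⟶ B) :
    Hom.cotangentMap f = 0 ↔ ∀ t : specOver K (DualNumber K) ⟶ A.X,
      specOverMapOfAlgHom (fstHom K K K) ≫ t = 1 → t ≫ f.hom.hom.hom = 1 :=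
  ⟨forall_tangent_comp_eq_one_of_cotangentMap_eq_zero K f,
    cotangentMap_eq_zero_of_forall_tangent_comp_eq_one f⟩

/-- **Endomorphism form of the dictionary:** `u^* = 0` on `𝔪_e/𝔪_e²` iff `u` kills every `K[ε]`-point
of `A` at the origin. [cite: GortzWedhorn2023, Rem. 27.18 (1) and (4) (pp. 805–806)] -/
theorem cotangentMap_end_eq_zero_iff_forall_tangent_comp_eq_one (u : A ⟶ A) :
    cotangentMap A u = 0 ↔ ∀ t : specOver K (DualNumber K) ⟶ A.X,
      specOverMapOfAlgHom (fstHom K K K) ≫ t = 1 → t ≫ u.hom.hom.hom = 1 := by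
  rw [cotangentMap_eq_hom_cotangentMap]
  exact cotangentMap_eq_zero_iff_forall_tangent_comp_eq_one u

end DualNumber

end AbelianVariety

end Literature.AlgebraicGeometry.Motives

end
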